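import Summits.Ventures.Crystal3D.Theorems.StickyWulffConstantNoReconstructionGainPredSlotBudgetRaisedZones
import HarnessLib

/-!
# The pred-slot budget with a raised up bond, three contacts: conic monotonicity, the pair step, the planar core

HONEST FRAMING. Part of the venture `Summits/Ventures/Crystal3D` (cell `crystal3d-full`), helper
`--supports` the crux `NoReconstructionGain` (stmt-Ventures-19144, route
`route-Ventures-StickyWulffConstant`), line `adhesion` (wulff-p1 g15).  Scalar bricks for regime II of
the hard failure system of B1b₃ (`predSlotBudget_of_upBond_raised_three`): three contacts deeper than
`T₀ = b + c` avoiding `W₁, W₂` (and `B₁`).  Everything is phrased in the SCALAR data of the tangent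
plane of `n` (conic = Cramer coordinates `λ, μ ≥ 0` of a tangent vector with respect to two generators,
Gram data `Q(·,·)`), so that the geometric file only instantiates:
* `conic_mono` — inside the wedge spanned by `K⊥, C⊥` the angle to `C⊥` is smaller than `∠(K⊥, C⊥)`;
* `chi_nonneg`, `pairGap_mono` — the required azimuth gap of two non-overlapping contacts is smallest
  when both sit on the `T₀`-circle: `(4−T₀²)²(2−d d′)² ≤ (2−T₀²)²(4−d²)(4−d′²)`;
* `planar_core` — THE TWO-CAP COVERING in the meridian plane `Π_U = span(n, U)` of a bad contact:
  the contact `U = (d/2, 1)` lies on the ellipse `2α² + β² ρ² = 2` and below the two cap lines, while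
  the points `(1/T₀, 0)`, `V_C` and the apex `X` (intersection of the two lines) are strictly inside —
  impossible by convexity.
WHAT THIS IS NOT: the 3D instantiation (corner points, lens vertices, the split meridian) and the
assembly, next files; rung F-C1 not moved.
-/

namespace Summit.Ventures.Crystal3D.Theorems

/-- **Conic monotonicity (scalar).**  If `D Q(U,C) = λ Kc + μ A` and `D² Q(U,U) = λ² KK + 2λμ Kc + μ² A`
with `λ ≥ 0`, `μ ≥ 0`, `A = Q(C,C) > 0`, `Kc = Q(K,C) ≥ 0`, `D > 0`, then `Q(U,C) ≥ 0` and
`Kc² Q(U,U) ≤ Q(U,C)² KK` (the angle from `U⊥` to `C⊥` is at most `∠(K⊥, C⊥)`), strictly if `μ > 0`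
and `Kc² < A·KK`. -/
theorem conic_mono {D lam mu A Kc KK QUC QUU : ℝ} (hlam : 0 ≤ lam) (hmu : 0 ≤ mu) (hA : 0 < A)
    (hKc : 0 ≤ Kc) (hD : 0 < D) (hdet : Kc ^ 2 ≤ A * KK)
    (C1 : D * QUC = lam * Kc + mu * A) (C2 : D ^ 2 * QUU = lam ^ 2 * KK + 2 * lam * mu * Kc + mu ^ 2 * A) :
    0 ≤ QUC ∧ Kc ^ 2 * QUU ≤ QUC ^ 2 * KK ∧ (0 < mu → Kc ^ 2 < A * KK → Kc ^ 2 * QUU < QUC ^ 2 * KK) := by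
  have key : D ^ 2 * (QUC ^ 2 * KK - Kc ^ 2 * QUU) = (A * KK - Kc ^ 2) * mu * (2 * lam * Kc + mu * A) := by
    have e1 : D ^ 2 * QUC ^ 2 = (lam * Kc + mu * A) ^ 2 := by rw [← C1]; ring
    linear_combination KK * e1 - Kc ^ 2 * C2
  have hD2 : 0 < D ^ 2 := by positivity
  refine ⟨?_, ?_, ?_⟩
  · have h1 : 0 ≤ D * QUC := by rw [C1]; positivity
    by_contra h; push Not at h
    linarith [mul_neg_of_pos_of_neg hD h]
  · have h : 0 ≤ D ^ 2 * (QUC ^ 2 * KK - Kc ^ 2 * QUU) := by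
      rw [key]; apply mul_nonneg (mul_nonneg (by linarith) hmu); positivity
    by_contra h'; push Not at h'
    linarith [mul_neg_of_pos_of_neg hD2 (by linarith : QUC ^ 2 * KK - Kc ^ 2 * QUU < 0)]
  · intro hmu' hdet'
    have h : 0 < D ^ 2 * (QUC ^ 2 * KK - Kc ^ 2 * QUU) := by
      rw [key]; apply mul_pos (mul_pos (by linarith) hmu'); positivity
    by_contra h'; push Not at h'
    linarith [mul_nonpos_of_nonneg_of_nonpos hD2.le (by linarith : QUC ^ 2 * KK - Kc ^ 2 * QUU ≤ 0)]

/-- `χ ≥ 0`: for `0 < T₀ < 2`, `1 ≤ e`, `T₀ ≤ d`, `d e ≤ 2`:  `(4−T₀²)(2−de)² ≤ (2−T₀e)²(4−d²)`. -/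
theorem chi_nonneg {T₀ d e : ℝ} (hT0 : 0 < T₀) (hT2 : T₀ < 2) (he : 1 ≤ e) (hd : T₀ ≤ d)
    (hde : d * e ≤ 2) : (4 - T₀ ^ 2) * (2 - d * e) ^ 2 ≤ (2 - T₀ * e) ^ 2 * (4 - d ^ 2) := by
  have hTe : T₀ * e ≤ 2 := by nlinarith
  have ident : e * ((2 - T₀ * e) ^ 2 * (4 - d ^ 2) - (4 - T₀ ^ 2) * (2 - d * e) ^ 2) =
      4 * (d - T₀) * ((e ^ 2 - 1) * (2 - T₀ * e) + (1 - T₀ * e + e ^ 2) * (2 - d * e)) := by ring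
  have h1 : 0 ≤ (e ^ 2 - 1) * (2 - T₀ * e) := mul_nonneg (by nlinarith) (by linarith)
  have h2 : 0 ≤ (1 - T₀ * e + e ^ 2) * (2 - d * e) :=
    mul_nonneg (by nlinarith [sq_nonneg (e - T₀ / 2)]) (by linarith)
  have h3 : 0 ≤ e * ((2 - T₀ * e) ^ 2 * (4 - d ^ 2) - (4 - T₀ ^ 2) * (2 - d * e) ^ 2) := by
    rw [ident]; have : 0 ≤ d - T₀ := by linarith
    positivity
  have he0 : 0 < e := by linarith
  have := nonneg_of_mul_nonneg_right (by rwa [mul_comm] at h3) he0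
  linarith

/-- **The pair gap is smallest on the circle.**  For `1 ≤ T₀ < 2`, `T₀ ≤ d`, `T₀ ≤ e`, `d e ≤ 2`:
`(4−T₀²)²(2−de)² ≤ (2−T₀²)²(4−d²)(4−e²)`. -/
theorem pairGap_mono {T₀ d e : ℝ} (hT1 : 1 ≤ T₀) (hT2 : T₀ < 2) (hd : T₀ ≤ d) (he : T₀ ≤ e)
    (hde : d * e ≤ 2) : (4 - T₀ ^ 2) ^ 2 * (2 - d * e) ^ 2 ≤ (2 - T₀ ^ 2) ^ 2 * (4 - d ^ 2) * (4 - e ^ 2) := by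
  have hT0 : 0 < T₀ := by linarith
  have s1 := chi_nonneg hT0 hT2 (le_trans hT1 he) hd hde
  have s2 := chi_nonneg (d := e) (e := T₀) hT0 hT2 hT1 he (by nlinarith)
  have h4d : 0 ≤ 4 - d ^ 2 := by nlinarith
  have h4T : 0 ≤ 4 - T₀ ^ 2 := by nlinarith
  have e1 : (2 - T₀ * T₀) = (2 - T₀ ^ 2) := by ring
  have e2 : (2 - e * T₀) = (2 - T₀ * e) := by ring
  rw [e1, e2] at s2
  calc (4 - T₀ ^ 2) ^ 2 * (2 - d * e) ^ 2 = (4 - T₀ ^ 2) * ((4 - T₀ ^ 2) * (2 - d * e) ^ 2) := by ring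
    _ ≤ (4 - T₀ ^ 2) * ((2 - T₀ * e) ^ 2 * (4 - d ^ 2)) := mul_le_mul_of_nonneg_left s1 h4T
    _ = ((4 - T₀ ^ 2) * (2 - T₀ * e) ^ 2) * (4 - d ^ 2) := by ring
    _ ≤ ((2 - T₀ ^ 2) ^ 2 * (4 - e ^ 2)) * (4 - d ^ 2) := mul_le_mul_of_nonneg_right s2 h4d
    _ = (2 - T₀ ^ 2) ^ 2 * (4 - d ^ 2) * (4 - e ^ 2) := by ring

/-- **Planar core of the two-cap covering.**  In the meridian plane of a contact (coordinates `(α, β)`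
with respect to `n` and the tangent part `u`, `|α n + β u|² = 2α² + β² ρ²`): the contact `(d/2, 1)` is
on the ellipse and satisfies both cap constraints (`L_C : α d_C + β k_C ≤ 1`, `L_W : α T₀ + β k_W ≤ 1`),
the point `V_C` of `L_C` with `α = T₀/2` and the apex `X = L_C ∩ L_W` are strictly inside the ellipse,
`T₀ > 1` (so `(1/T₀, 0) ∈ L_W` is inside), `d > T₀`, `d_C ≥ 0`, `k_C > 0`: contradiction. -/
theorem planar_core {T₀ d dC kC kW r2 βC αX βX : ℝ} (hT0 : 1 < T₀) (hdT : T₀ < d) (hdC : 0 ≤ dC)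
    (hkC : 0 < kC) (hr : 0 < r2) (hU : d ^ 2 / 2 + r2 = 2)
    (hUC : d * dC / 2 + kC ≤ 1) (hUW : d * T₀ / 2 + kW ≤ 1)
    (hVC : T₀ * dC / 2 + βC * kC = 1) (hVCin : T₀ ^ 2 / 2 + βC ^ 2 * r2 < 2)
    (hXC : αX * dC + βX * kC = 1) (hXW : αX * T₀ + βX * kW = 1) (hXin : 2 * αX ^ 2 + βX ^ 2 * r2 < 2) :
    False := by
  have hd0 : 0 < d := by linarith
  rcases le_or_gt 1 βX with hbX | hbX
  · -- apex above the contact's level: interpolate on `L_W` between `(1/T₀, 0)` and `X`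
    -- `F(β) := T₀² q((1 - β kW)/T₀, β) = 2 (1 - β kW)² + β² r2 T₀²` is convex; `F(0) = 2 < 2T₀²`,
    -- `F(βX) = T₀² q(X) < 2 T₀²`, hence `F(1) < 2 T₀²`; but the contact gives `F(1) ≥ 2 T₀²`.
    have hT2 : 0 < T₀ ^ 2 := by positivity
    have FX : 2 * (1 - βX * kW) ^ 2 + βX ^ 2 * r2 * T₀ ^ 2 < 2 * T₀ ^ 2 := by
      have e : 1 - βX * kW = αX * T₀ := by linarith
      rw [e]; nlinarith [mul_lt_mul_of_pos_left hXin hT2]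
    have conv : (βX - 1) * 2 + (2 * (1 - βX * kW) ^ 2 + βX ^ 2 * r2 * T₀ ^ 2) -
        βX * (2 * (1 - kW) ^ 2 + r2 * T₀ ^ 2) = (2 * kW ^ 2 + r2 * T₀ ^ 2) * (βX * (βX - 1)) := by ring
    have conv' : 0 ≤ (2 * kW ^ 2 + r2 * T₀ ^ 2) * (βX * (βX - 1)) := by
      apply mul_nonneg (by positivity); exact mul_nonneg (by linarith) (by linarith)
    have h22 : (βX - 1) * 2 ≤ (βX - 1) * (2 * T₀ ^ 2) := mul_le_mul_of_nonneg_left (by nlinarith) (by linarith)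
    have F1 : 2 * (1 - kW) ^ 2 + r2 * T₀ ^ 2 < 2 * T₀ ^ 2 := by
      by_contra h; push Not at h
      have : βX * (2 * T₀ ^ 2) ≤ βX * (2 * (1 - kW) ^ 2 + r2 * T₀ ^ 2) := mul_le_mul_of_nonneg_left h (by linarith)
      linarith
    have hk : d * T₀ / 2 ≤ 1 - kW := by linarith
    have hk0 : 0 ≤ d * T₀ / 2 := by positivity
    have hsq : (d * T₀ / 2) ^ 2 ≤ (1 - kW) ^ 2 := pow_le_pow_left₀ hk0 hk 2
    have h5 : 2 * (d * T₀ / 2) ^ 2 + r2 * T₀ ^ 2 = 2 * T₀ ^ 2 := by linear_combination T₀ ^ 2 * hU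
    linarith
  · rcases le_or_gt βC 1 with hbC | hbC
    · -- `βC ≤ 1`: the contact is left of `V_C`, i.e. `d ≤ T₀`
      rcases hdC.lt_or_eq with hdC' | hdC'
      · have h1 : d * dC / 2 + kC ≤ T₀ * dC / 2 + kC := by
          have : βC * kC ≤ 1 * kC := mul_le_mul_of_nonneg_right hbC hkC.le
          linarith
        have h2 : T₀ * dC < d * dC := mul_lt_mul_of_pos_right hdT hdC'
        linarith
      · -- `dC = 0`: `L_C` is horizontal, `βX = βC = 1/kC`
        rw [← hdC'] at hVC hXC hUC
        have e1 : βC * kC = 1 := by linarith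
        have e2 : βX * kC = 1 := by linarith
        have h3 : (βC - βX) * kC = 0 := by linarith
        have h4 : βC - βX = 0 := by
          rcases mul_eq_zero.1 h3 with h | h
          · exact h
          · exact absurd h hkC.ne'
        have hkC1 : kC ≤ 1 := by linarith
        have : (1 : ℝ) ≤ βC := by
          by_contra h; push Not at h
          have := mul_lt_mul_of_pos_right h hkC
          linarith
        linarith
    · -- `βX < 1 < βC`: interpolate on `L_C` between `X` and `V_C`
      rcases hdC.lt_or_eq with hdC' | hdC'
      · -- `G(β) := dC² q((1 - β kC)/dC, β) = 2(1 - β kC)² + β² r2 dC²`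
        have hD2 : 0 < dC ^ 2 := by positivity
        have GX : 2 * (1 - βX * kC) ^ 2 + βX ^ 2 * r2 * dC ^ 2 < 2 * dC ^ 2 := by
          have e : 1 - βX * kC = αX * dC := by linarith
          rw [e]; nlinarith [mul_lt_mul_of_pos_left hXin hD2]
        have GC : 2 * (1 - βC * kC) ^ 2 + βC ^ 2 * r2 * dC ^ 2 < 2 * dC ^ 2 := by
          have e : 1 - βC * kC = T₀ * dC / 2 := by linarith
          rw [e]; nlinarith [mul_lt_mul_of_pos_left hVCin hD2]
        -- convexity: (βC - βX) G(1) ≤ (βC - 1) G(βX) + (1 - βX) G(βC)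
        have conv : (βC - 1) * (2 * (1 - βX * kC) ^ 2 + βX ^ 2 * r2 * dC ^ 2) +
            (1 - βX) * (2 * (1 - βC * kC) ^ 2 + βC ^ 2 * r2 * dC ^ 2) -
            (βC - βX) * (2 * (1 - kC) ^ 2 + r2 * dC ^ 2) =
            (2 * kC ^ 2 + r2 * dC ^ 2) * ((βC - 1) * (1 - βX) * (βC - βX)) := by ring
        have conv' : 0 ≤ (2 * kC ^ 2 + r2 * dC ^ 2) * ((βC - 1) * (1 - βX) * (βC - βX)) := by
          apply mul_nonneg (by positivity)
          apply mul_nonneg (mul_nonneg (by linarith) (by linarith)) (by linarith)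
        have G1 : 2 * (1 - kC) ^ 2 + r2 * dC ^ 2 < 2 * dC ^ 2 := by
          have h1 : 0 < βC - 1 := by linarith
          have h2 : 0 < 1 - βX := by linarith
          have e1 := mul_lt_mul_of_pos_left GX h1
          have e2 := mul_lt_mul_of_pos_left GC h2
          by_contra h; push Not at h
          have e3 : (βC - βX) * (2 * dC ^ 2) ≤ (βC - βX) * (2 * (1 - kC) ^ 2 + r2 * dC ^ 2) :=
            mul_le_mul_of_nonneg_left h (by linarith)
          linarith
        have hk : d * dC / 2 ≤ 1 - kC := by linarith
        have hk0 : 0 ≤ d * dC / 2 := by positivity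
        have hsq : (d * dC / 2) ^ 2 ≤ (1 - kC) ^ 2 := pow_le_pow_left₀ hk0 hk 2
        have h5 : 2 * (d * dC / 2) ^ 2 + r2 * dC ^ 2 = 2 * dC ^ 2 := by linear_combination dC ^ 2 * hU
        linarith
      · rw [← hdC'] at hVC hXC
        have e1 : βC * kC = 1 := by linarith
        have e2 : βX * kC = 1 := by linarith
        have : βX * kC < βC * kC := mul_lt_mul_of_pos_right (by linarith) hkC
        linarith

end Summit.Ventures.Crystal3D.Theorems
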